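import Summits.QuantumFields.YangMills.Theorems.BalabanUVNodesN21CollarLetterOdds
import Summits.QuantumFields.YangMills.Theorems.BalabanUVNodesN21RecentredDilationTransversal

/-!
# N21 (NE7c) · THE COLLAR'S ENVELOPE ODDS IN P2's FRAME AND THE JUNCTION: (M1) on the cut law by re-centred dilation
# with the collar's odds PRODUCED — dropped `≥`-cuts and relaxed kept letters ride in ONE envelope

R141 (C) seat pub-ymgap-dag-n21-e (g15), node N21 = NE7c (single-run shell-weight bound, NOT PRINTED in [Bałaban
1983–89], NOT proved), strategy s3 ALTERNATIVE CURRENCY, lane K3⁷ `SpineGivenEndpointR13SepCoPH`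
(stmt-QuantumFields-20544, `--kind proof --supports … --as helper`).  Part 38l of this seat's series; successor of 38i
(p569648), 38j `…N21CollarOddsBlockFrame`, 38k `…N21CollarLetterOdds`; consumes n21-d part 28
`…N21RecentredDilationTransversal` (p571948; mathematics = lens v27.0 ROW P) BY NAME.

WHY.  Road II's re-centred END, P2 `slotAntiConcentration_restrict_of_recentredDilation`, gives (M1)
`SlotAntiConcentration (ν|({U<θ} ∩ C)) U θ ρ (3(#κ+1)(1+Q)∕(κ₀(1−ρ)))` from non-collapse ∕ envelope ∕ transversality
about a measurable centre AND one odds binder `hQ : ν(Env ∖ ({U<θ} ∩ C)) ≤ Q·ν({U<θ} ∩ C)`.  At the Γ-collar the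
envelope exceeds the support coordinate by coordinate (lens Cards 71 ∕ 79 ∕ 83): a dropped `≥`-cut `{bᵢ ≤ w_i}` by
its left shell (38i ∕ 38j), a kept two-sided letter `{|w_i| < θᵢ}` by its outer shells (38k).  This file closes the
junction: the per-coordinate conditional odds — whatever the species — multiply along 38i §1's abstract product in
P2's frame, and P2 is applied with `hQ` DISCHARGED.
* §1 (any measure `ν` on `X × (κ → ℝ)`; coordinate letters `{q | q.2 i ∈ P₁ i} ⊆ {q | q.2 i ∈ E₁ i}` with Borel
  `P₁ i ⊆ E₁ i ⊆ ℝ`; per-coordinate odds `Qᵢ` conditional on every measurable event reading no coordinate `i`)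
  `coordSet_inter_notRead` · ★ `coordLetterOddsProduct_block` (38i `measure_biInter_env_le_prod_of_condOdds` BY NAME)
  · ★ `coordLetterEnvelopeOdds_block` (38i `measure_biInter_env_diff_le_of_condOdds` BY NAME: P2's `hQ` with
  `Q = ∏ᵢ (1+Qᵢ) − 1`, rest `R` measurable reading no collar coordinate);
* §2 the two species in §1's `hodds` shape: `hodds_geCut_of_partialSlope` (38j `condOdds_blockCoord_of_partialSlope`,
  `P₁ = [b, ∞)`, `E₁ = [a, ∞)`, `Q = c∕(1−c)`) and `hodds_absLetter_of_partialSlopes` (38k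
  `condOdds_absBlockCoord_of_partialSlopes`, `P₁ = (−θ, θ)`, `E₁ = (−θ′, θ′)`, `Q = 2c∕(1−c)`);
* §3 ★★ THE JUNCTION `slotAntiConcentration_restrict_of_recentredDilation_collar`: P2 with
  `C := C⋆ ∩ ⋂ᵢ {q.2 i ∈ P₁ i}`, `Env := (⋂ᵢ {q.2 i ∈ E₁ i}) ∩ ({U<θ} ∩ C⋆)` and `hQ` supplied by §1 — (M1) on the
  cut law with constant `3(#κ+1)·∏ᵢ(1+Qᵢ)∕(κ₀(1−ρ))`; P2's three binders about the centre and the not-read structure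
  of `U`, `C⋆` stay DISPLAYED;
* §4 A6 witnesses (director-ym STANDING A6 RULE №189 (3)): §1's END on the Gaussian block weight over the one-point
  exterior with ONE letter coordinate (38k's witness data) — `collarEnvelopeOdds_binders_inhabited`; and the
  JUNCTION's END with EVERY binder (P2's three included) discharged — `collarJunction_binders_inhabited`
  (`m = 0`, `U = |w₁|`, `θ = 1`, `ρ = ½`, `κ₀ = 1`).

HONEST FRAMING.  [textbook] measure theory + real arithmetic; 0 def, 0 sorry; slopes, shells, thresholds, the centre
`m` and the not-read structure are HYPOTHESES (NODE O's term object ∕ n21-d's hazard numbers ∕ lens Card 80–83's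
located numbers, none asserted); nothing of Bałaban's asserted ([Balaban1989LargeFieldI] p. 176 ∕ p. 193 = the
located MECHANISM only); NE7c NOT PRINTED ∕ NOT proved; N21 NOT discharged; counts unmoved (typed 28∕28 · discharged
5∕27); count-neutral; one finite 𝕋⁴ at fixed ε — nothing about ℝ⁴ ∕ OS ∕ mass gap ∕ Clay.
-/

set_option autoImplicit false

open MeasureTheory Set Function
open scoped ENNReal

namespace Summit.QuantumFields.YangMills.Theorems.N21CollarEnvelopeOdds

open Literature.MathematicalPhysics.QuantumFieldTheory.Balaban1983to89.T4ShellMeasure (SlotAntiConcentration)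
open Summit.QuantumFields.YangMills.Theorems.N21CollarOddsProduct
  (measure_biInter_env_le_prod_of_condOdds measure_biInter_env_diff_le_of_condOdds)
open Summit.QuantumFields.YangMills.Theorems.N21CollarOddsBlockFrame
  (condOdds_blockCoord_of_partialSlope isFiniteMeasure_blockGaussianWeight)
open Summit.QuantumFields.YangMills.Theorems.N21CollarLetterOdds
  (condOdds_absBlockCoord_of_partialSlopes gaussianBlock_inwardSlopes)
open Summit.QuantumFields.YangMills.Theorems.N21RecentredDilationTransversal
  (slotAntiConcentration_restrict_of_recentredDilation)

variable {X : Type*} [MeasurableSpace X] {κ : Type*} [Fintype κ] [DecidableEq κ]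

/-! ## §1 Coordinate letters of any species: the product of their conditional odds in the block frame -/

section Generic

variable (ν : Measure (X × (κ → ℝ)))

omit [Fintype κ] in
/-- closure bookkeeping: intersecting with a coordinate set `{q | q.2 j ∈ B}` (`j ≠ i`, `B` Borel) keeps an event
measurable and not read by coordinate `i`. [textbook] -/
theorem coordSet_inter_notRead {B : Set ℝ} (hB : MeasurableSet B) {i j : κ} (hji : j ≠ i)
    {C : Set (X × (κ → ℝ))}
    (hC : MeasurableSet C ∧ ∀ (z : X) (w : κ → ℝ) (y : ℝ), (z, update w i y) ∈ C ↔ (z, w) ∈ C) :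
    MeasurableSet ({q : X × (κ → ℝ) | q.2 j ∈ B} ∩ C) ∧
      ∀ (z : X) (w : κ → ℝ) (y : ℝ),
        (z, update w i y) ∈ {q : X × (κ → ℝ) | q.2 j ∈ B} ∩ C ↔ (z, w) ∈ {q : X × (κ → ℝ) | q.2 j ∈ B} ∩ C := by
  refine ⟨(((measurable_pi_apply j).comp measurable_snd) hB).inter hC.1, fun z w y => ?_⟩
  simp only [mem_inter_iff, mem_setOf_eq, update_of_ne hji, hC.2]

omit [Fintype κ] in
/-- **★ THE PRODUCT OF COORDINATE-LETTER ODDS IN THE BLOCK FRAME.**  Any measure `ν` on `X × (κ → ℝ)`; collar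
coordinates `M`; for each, a support letter `{q.2 i ∈ P₁ i}` inside an envelope letter `{q.2 i ∈ E₁ i}` (Borel
`P₁ i, E₁ i ⊆ ℝ`) and odds `Qᵢ ≥ 0` such that `ν(({q.2 i ∈ E₁ i} ∖ {q.2 i ∈ P₁ i}) ∩ C) ≤ Qᵢ·ν({q.2 i ∈ P₁ i} ∩ C)` for
every measurable `C` not reading coordinate `i` (species: §2); rest `R` measurable reading no collar coordinate.
Then `ν((⋂ᵢ {q.2 i ∈ E₁ i}) ∩ R) ≤ ∏ᵢ (1+Qᵢ) · ν((⋂ᵢ {q.2 i ∈ P₁ i}) ∩ R)` (38i §1 BY NAME). [textbook] -/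
theorem coordLetterOddsProduct_block (M : Finset κ) (P₁ E₁ : κ → Set ℝ)
    (hP₁ : ∀ i ∈ M, MeasurableSet (P₁ i)) (hE₁ : ∀ i ∈ M, MeasurableSet (E₁ i)) (Q : κ → ℝ)
    (hQ0 : ∀ i ∈ M, 0 ≤ Q i)
    (hodds : ∀ i ∈ M, ∀ C : Set (X × (κ → ℝ)), MeasurableSet C →
      (∀ (z : X) (w : κ → ℝ) (y : ℝ), (z, update w i y) ∈ C ↔ (z, w) ∈ C) →
      ν (({q | q.2 i ∈ E₁ i} \ {q | q.2 i ∈ P₁ i}) ∩ C) ≤ ENNReal.ofReal (Q i) * ν ({q | q.2 i ∈ P₁ i} ∩ C))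
    {R : Set (X × (κ → ℝ))} (hRm : MeasurableSet R)
    (hR : ∀ i ∈ M, ∀ (z : X) (w : κ → ℝ) (y : ℝ), (z, update w i y) ∈ R ↔ (z, w) ∈ R) :
    ν ((⋂ i ∈ M, {q : X × (κ → ℝ) | q.2 i ∈ E₁ i}) ∩ R)
      ≤ ENNReal.ofReal (∏ i ∈ M, (1 + Q i)) * ν ((⋂ i ∈ M, {q : X × (κ → ℝ) | q.2 i ∈ P₁ i}) ∩ R) :=
  measure_biInter_env_le_prod_of_condOdds ν (fun i => {q : X × (κ → ℝ) | q.2 i ∈ P₁ i})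
    (fun i => {q : X × (κ → ℝ) | q.2 i ∈ E₁ i}) Q
    (fun i C => MeasurableSet C ∧ ∀ (z : X) (w : κ → ℝ) (y : ℝ), (z, update w i y) ∈ C ↔ (z, w) ∈ C) M hQ0
    (fun _ _ j hj hji _ hC => coordSet_inter_notRead (hP₁ j hj) hji hC)
    (fun _ _ j hj hji _ hC => coordSet_inter_notRead (hE₁ j hj) hji hC)
    (fun i hi C hC => hodds i hi C hC.1 hC.2) (fun i hi => ⟨hRm, hR i hi⟩)

omit [Fintype κ] in
/-- **★ P2's `hQ`, PRODUCED FOR ANY MIX OF SPECIES.**  Same data with `P₁ i ⊆ E₁ i` and `ν` finite: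
`ν(((⋂ᵢ {q.2 i ∈ E₁ i}) ∩ R) ∖ ((⋂ᵢ {q.2 i ∈ P₁ i}) ∩ R)) ≤ (∏ᵢ (1+Qᵢ) − 1) · ν((⋂ᵢ {q.2 i ∈ P₁ i}) ∩ R)` — the binder
`hQ` of `…N21RecentredDilationTransversal.slotAntiConcentration_restrict_of_recentredDilation` with
`Env := (⋂ᵢ {q.2 i ∈ E₁ i}) ∩ R`, `{U<θ} ∩ C = (⋂ᵢ {q.2 i ∈ P₁ i}) ∩ R` (38i §1 BY NAME). [textbook] -/
theorem coordLetterEnvelopeOdds_block [IsFiniteMeasure ν] (M : Finset κ) (P₁ E₁ : κ → Set ℝ)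
    (hP₁ : ∀ i ∈ M, MeasurableSet (P₁ i)) (hE₁ : ∀ i ∈ M, MeasurableSet (E₁ i)) (hPE : ∀ i ∈ M, P₁ i ⊆ E₁ i)
    (Q : κ → ℝ) (hQ0 : ∀ i ∈ M, 0 ≤ Q i)
    (hodds : ∀ i ∈ M, ∀ C : Set (X × (κ → ℝ)), MeasurableSet C →
      (∀ (z : X) (w : κ → ℝ) (y : ℝ), (z, update w i y) ∈ C ↔ (z, w) ∈ C) →
      ν (({q | q.2 i ∈ E₁ i} \ {q | q.2 i ∈ P₁ i}) ∩ C) ≤ ENNReal.ofReal (Q i) * ν ({q | q.2 i ∈ P₁ i} ∩ C))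
    {R : Set (X × (κ → ℝ))} (hRm : MeasurableSet R)
    (hR : ∀ i ∈ M, ∀ (z : X) (w : κ → ℝ) (y : ℝ), (z, update w i y) ∈ R ↔ (z, w) ∈ R) :
    ν (((⋂ i ∈ M, {q : X × (κ → ℝ) | q.2 i ∈ E₁ i}) ∩ R) \ ((⋂ i ∈ M, {q : X × (κ → ℝ) | q.2 i ∈ P₁ i}) ∩ R))
      ≤ ENNReal.ofReal (∏ i ∈ M, (1 + Q i) - 1) *
        ν ((⋂ i ∈ M, {q : X × (κ → ℝ) | q.2 i ∈ P₁ i}) ∩ R) := by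
  have hu : ∀ j : κ, Measurable fun p : X × (κ → ℝ) => p.2 j := fun j => (measurable_pi_apply j).comp measurable_snd
  have hPm : MeasurableSet ((⋂ i ∈ M, {q : X × (κ → ℝ) | q.2 i ∈ P₁ i}) ∩ R) :=
    (Finset.measurableSet_biInter M fun i hi => (hu i) (hP₁ i hi)).inter hRm
  exact measure_biInter_env_diff_le_of_condOdds ν (fun i => {q : X × (κ → ℝ) | q.2 i ∈ P₁ i})
    (fun i => {q : X × (κ → ℝ) | q.2 i ∈ E₁ i}) Q
    (fun i C => MeasurableSet C ∧ ∀ (z : X) (w : κ → ℝ) (y : ℝ), (z, update w i y) ∈ C ↔ (z, w) ∈ C) M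
    (fun i hi q hq => hPE i hi hq) hQ0
    (fun _ _ j hj hji _ hC => coordSet_inter_notRead (hP₁ j hj) hji hC)
    (fun _ _ j hj hji _ hC => coordSet_inter_notRead (hE₁ j hj) hji hC)
    (fun i hi C hC => hodds i hi C hC.1 hC.2) (fun i hi => ⟨hRm, hR i hi⟩) hPm (measure_ne_top ν _)

end Generic

/-! ## §2 The two species in §1's `hodds` shape -/

section Species

variable (ζ : Measure X)

/-- **DROPPED `≥`-CUT** (38j `condOdds_blockCoord_of_partialSlope` BY NAME): support `[b, ∞)`, envelope `[a, ∞)`,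
odds `c∕(1−c)`, `c = e·Λ·(b−a)`. [textbook] -/
theorem hodds_geCut_of_partialSlope {A : X × (κ → ℝ) → ℝ} (hA : Measurable A)
    [IsFiniteMeasure ((ζ.prod volume).withDensity fun p : X × (κ → ℝ) => ENNReal.ofReal (Real.exp (-A p)))]
    (i : κ) {a b Λ : ℝ} (hΛ : 0 < Λ) (hab : a ≤ b) (hc1 : Real.exp 1 * Λ * (b - a) < 1)
    (hslope : ∀ (z : X) (w : κ → ℝ), ∀ y₁ ∈ Ico a b, ∀ y₂ ∈ Icc y₁ (y₁ + Λ⁻¹),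
      A (z, update w i y₂) - A (z, update w i y₁) ≤ Λ * (y₂ - y₁))
    (C : Set (X × (κ → ℝ))) (hC : MeasurableSet C)
    (hCi : ∀ (z : X) (w : κ → ℝ) (y : ℝ), (z, update w i y) ∈ C ↔ (z, w) ∈ C) :
    ((ζ.prod volume).withDensity fun p : X × (κ → ℝ) => ENNReal.ofReal (Real.exp (-A p)))
        (({q | q.2 i ∈ Ici a} \ {q | q.2 i ∈ Ici b}) ∩ C)
      ≤ ENNReal.ofReal (Real.exp 1 * Λ * (b - a) / (1 - Real.exp 1 * Λ * (b - a))) *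
        ((ζ.prod volume).withDensity fun p : X × (κ → ℝ) => ENNReal.ofReal (Real.exp (-A p)))
          ({q | q.2 i ∈ Ici b} ∩ C) := by
  have hset : ({q : X × (κ → ℝ) | q.2 i ∈ Ici a} \ {q | q.2 i ∈ Ici b}) = {q | a ≤ q.2 i ∧ q.2 i < b} := by
    ext q; simp only [mem_sdiff, mem_setOf_eq, mem_Ici, not_le]
  rw [hset]
  exact condOdds_blockCoord_of_partialSlope ζ hA i hΛ hab hc1 hslope hC hCi

/-- **KEPT TWO-SIDED LETTER** (38k `condOdds_absBlockCoord_of_partialSlopes` BY NAME): support `(−θ, θ)`, envelope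
`(−θ′, θ′)`, odds `2c∕(1−c)`, `c = e·Λ·(θ′−θ)`. [textbook] -/
theorem hodds_absLetter_of_partialSlopes {A : X × (κ → ℝ) → ℝ} (hA : Measurable A)
    [IsFiniteMeasure ((ζ.prod volume).withDensity fun p : X × (κ → ℝ) => ENNReal.ofReal (Real.exp (-A p)))]
    (i : κ) {θ θ' Λ : ℝ} (hΛ : 0 < Λ) (hwin : Λ⁻¹ < 2 * θ) (hθθ' : θ ≤ θ')
    (hc1 : Real.exp 1 * Λ * (θ' - θ) < 1)
    (hup : ∀ (z : X) (w : κ → ℝ), ∀ y₁ ∈ Ico θ θ', ∀ y₂ ∈ Icc (y₁ - Λ⁻¹) y₁,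
      A (z, update w i y₂) - A (z, update w i y₁) ≤ Λ * (y₁ - y₂))
    (hlow : ∀ (z : X) (w : κ → ℝ), ∀ y₁ ∈ Ioc (-θ') (-θ), ∀ y₂ ∈ Icc y₁ (y₁ + Λ⁻¹),
      A (z, update w i y₂) - A (z, update w i y₁) ≤ Λ * (y₂ - y₁))
    (C : Set (X × (κ → ℝ))) (hC : MeasurableSet C)
    (hCi : ∀ (z : X) (w : κ → ℝ) (y : ℝ), (z, update w i y) ∈ C ↔ (z, w) ∈ C) :
    ((ζ.prod volume).withDensity fun p : X × (κ → ℝ) => ENNReal.ofReal (Real.exp (-A p)))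
        (({q | q.2 i ∈ Ioo (-θ') θ'} \ {q | q.2 i ∈ Ioo (-θ) θ}) ∩ C)
      ≤ ENNReal.ofReal (2 * (Real.exp 1 * Λ * (θ' - θ) / (1 - Real.exp 1 * Λ * (θ' - θ)))) *
        ((ζ.prod volume).withDensity fun p : X × (κ → ℝ) => ENNReal.ofReal (Real.exp (-A p)))
          ({q | q.2 i ∈ Ioo (-θ) θ} ∩ C) :=
  condOdds_absBlockCoord_of_partialSlopes ζ hA i hΛ hwin hθθ' hc1 hup hlow hC hCi

end Species

/-! ## §3 The junction with P2: (M1) on the cut law by re-centred dilation, the collar's odds produced -/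

/-- **★★ THE JUNCTION.**  P2 (`…N21RecentredDilationTransversal.slotAntiConcentration_restrict_of_recentredDilation`,
n21-d part 28 = lens ROW P) for the cut law `ν = (ζ ⊗ vol).withDensity g` of finite mass on `X × (κ → ℝ)`, with the
cut event split as `C := C⋆ ∩ ⋂_{i∈M} {q.2 i ∈ P₁ i}` (the collar's support letters, any species) and the envelope
`Env := (⋂_{i∈M} {q.2 i ∈ E₁ i}) ∩ ({U<θ} ∩ C⋆)`; `U` and `C⋆` read no collar coordinate; per-coordinate conditional
odds `Qᵢ` as in §1 (§2 supplies them).  P2's non-collapse ∕ envelope ∕ transversality binders about the centre `m`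
are DISPLAYED unchanged; its `hQ` is DISCHARGED by §1 ⇒
`SlotAntiConcentration (ν|({U<θ} ∩ C)) U θ ρ (3(#κ+1)·∏ᵢ(1+Qᵢ)∕(κ₀(1−ρ)))`. [textbook] -/
theorem slotAntiConcentration_restrict_of_recentredDilation_collar [Nonempty κ] (ζ : Measure X) [SFinite ζ]
    {m : X → (κ → ℝ)} (hm : Measurable m)
    {g : X × (κ → ℝ) → ℝ≥0∞} (hg : Measurable g) [IsFiniteMeasure ((ζ.prod volume).withDensity g)]
    {U : X × (κ → ℝ) → ℝ} (hUm : Measurable U)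
    {Cstar : Set (X × (κ → ℝ))} (hCstar : MeasurableSet Cstar)
    (M : Finset κ) (P₁ E₁ : κ → Set ℝ) (hP₁ : ∀ i ∈ M, MeasurableSet (P₁ i))
    (hE₁ : ∀ i ∈ M, MeasurableSet (E₁ i)) (hPE : ∀ i ∈ M, P₁ i ⊆ E₁ i) (Q : κ → ℝ) (hQ0 : ∀ i ∈ M, 0 ≤ Q i)
    (hodds : ∀ i ∈ M, ∀ C : Set (X × (κ → ℝ)), MeasurableSet C →
      (∀ (z : X) (w : κ → ℝ) (y : ℝ), (z, update w i y) ∈ C ↔ (z, w) ∈ C) →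
      ((ζ.prod volume).withDensity g) (({q | q.2 i ∈ E₁ i} \ {q | q.2 i ∈ P₁ i}) ∩ C)
        ≤ ENNReal.ofReal (Q i) * ((ζ.prod volume).withDensity g) ({q | q.2 i ∈ P₁ i} ∩ C))
    (hUi : ∀ i ∈ M, ∀ (z : X) (w : κ → ℝ) (y : ℝ), U (z, update w i y) = U (z, w))
    (hCi : ∀ i ∈ M, ∀ (z : X) (w : κ → ℝ) (y : ℝ), (z, update w i y) ∈ Cstar ↔ (z, w) ∈ Cstar)
    {θ ρ κ₀ : ℝ} (hθ : 0 < θ) (hρ0 : 0 < ρ) (hρ1 : ρ < 1) (hκ : 0 < κ₀)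
    (henv : ∀ l ∈ Icc (1 - 1 / ((Fintype.card κ : ℝ) + 1)) 1, ∀ p : X × (κ → ℝ),
      θ * (1 - ρ) ≤ U p → U p < θ → p ∈ Cstar ∩ ⋂ i ∈ M, {q : X × (κ → ℝ) | q.2 i ∈ P₁ i} →
        (p.1, m p.1 + l • (p.2 - m p.1))
          ∈ (⋂ i ∈ M, {q : X × (κ → ℝ) | q.2 i ∈ E₁ i}) ∩ ({q | U q < θ} ∩ Cstar))
    (hmono : ∀ l ∈ Icc (1 - 1 / ((Fintype.card κ : ℝ) + 1)) 1, ∀ p : X × (κ → ℝ),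
      θ * (1 - ρ) ≤ U p → U p < θ → p ∈ Cstar ∩ ⋂ i ∈ M, {q : X × (κ → ℝ) | q.2 i ∈ P₁ i} →
        g p ≤ g (p.1, m p.1 + l • (p.2 - m p.1)))
    (hRT : ∀ p : X × (κ → ℝ), θ * (1 - ρ) ≤ U p → U p < θ →
      p ∈ Cstar ∩ ⋂ i ∈ M, {q : X × (κ → ℝ) | q.2 i ∈ P₁ i} → ∀ s : ℝ, 1 ≤ s →
      θ * (1 - ρ) ≤ U (p.1, m p.1 + s • (p.2 - m p.1)) → U (p.1, m p.1 + s • (p.2 - m p.1)) < θ →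
        (p.1, m p.1 + s • (p.2 - m p.1)) ∈ Cstar ∩ ⋂ i ∈ M, {q : X × (κ → ℝ) | q.2 i ∈ P₁ i} →
          U p + κ₀ * (θ * (1 - ρ)) * (s - 1) ≤ U (p.1, m p.1 + s • (p.2 - m p.1))) :
    SlotAntiConcentration
      (((ζ.prod volume).withDensity g).restrict
        ({p | U p < θ} ∩ (Cstar ∩ ⋂ i ∈ M, {q : X × (κ → ℝ) | q.2 i ∈ P₁ i}))) U θ ρ
      (3 * ((Fintype.card κ : ℝ) + 1) * (∏ i ∈ M, (1 + Q i)) / (κ₀ * (1 - ρ))) := by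
  have hu : ∀ j : κ, Measurable fun p : X × (κ → ℝ) => p.2 j := fun j => (measurable_pi_apply j).comp measurable_snd
  -- the rest event `{U<θ} ∩ C⋆` is measurable and reads no collar coordinate
  have hRm : MeasurableSet ({q : X × (κ → ℝ) | U q < θ} ∩ Cstar) :=
    (measurableSet_lt hUm measurable_const).inter hCstar
  have hR : ∀ i ∈ M, ∀ (z : X) (w : κ → ℝ) (y : ℝ),
      (z, update w i y) ∈ {q : X × (κ → ℝ) | U q < θ} ∩ Cstar ↔ (z, w) ∈ {q : X × (κ → ℝ) | U q < θ} ∩ Cstar := by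
    intro i hi z w y
    simp only [mem_inter_iff, mem_setOf_eq, hUi i hi, hCi i hi]
  have hPm : MeasurableSet (⋂ i ∈ M, {q : X × (κ → ℝ) | q.2 i ∈ P₁ i}) :=
    Finset.measurableSet_biInter M fun i hi => (hu i) (hP₁ i hi)
  have hEm : MeasurableSet ((⋂ i ∈ M, {q : X × (κ → ℝ) | q.2 i ∈ E₁ i}) ∩ ({q | U q < θ} ∩ Cstar)) :=
    (Finset.measurableSet_biInter M fun i hi => (hu i) (hE₁ i hi)).inter hRm
  -- the cut event is the support letters inside the rest
  have hPC : {p : X × (κ → ℝ) | U p < θ} ∩ (Cstar ∩ ⋂ i ∈ M, {q : X × (κ → ℝ) | q.2 i ∈ P₁ i})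
      = (⋂ i ∈ M, {q : X × (κ → ℝ) | q.2 i ∈ P₁ i}) ∩ ({q | U q < θ} ∩ Cstar) := by
    rw [← inter_assoc, inter_comm]
  -- `hQ` produced by §1
  have hQ := coordLetterEnvelopeOdds_block ((ζ.prod volume).withDensity g) M P₁ E₁ hP₁ hE₁ hPE Q hQ0 hodds hRm hR
  rw [← hPC] at hQ
  have hQ0' : 0 ≤ ∏ i ∈ M, (1 + Q i) - 1 :=
    sub_nonneg.2 (Finset.one_le_prod fun i hi => by linarith [hQ0 i hi])
  have h := slotAntiConcentration_restrict_of_recentredDilation ζ hm hg hUm (hCstar.inter hPm) hEm hθ hρ0 hρ1 hκ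
    hQ0' henv hmono hRT hQ
  rwa [add_sub_cancel] at h

/-! ## §4 A6 witness: the binders of §1 are jointly inhabited (one-point exterior, Gaussian block, one kept letter) -/

/-- **A6 WITNESS** (director-ym STANDING A6 RULE №189 (3)): §1's END `coordLetterEnvelopeOdds_block` APPLIED — exterior
`X = Unit` under `dirac ()`, block `ℝ²` under the Gaussian weight, `M = {0}` with the kept letter `(−1, 1)` relaxed
to `(−7∕6, 7∕6)` at odds `2c∕(1−c)`, `c = e∕3` (§2 `hodds_absLetter_of_partialSlopes` with 38k's witness slopes),
rest event `univ` — every binder discharged in the kernel; a satisfiability witness, not an estimate on Bałaban's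
measure. [textbook] -/
theorem collarEnvelopeOdds_binders_inhabited :
    (((Measure.dirac ()).prod (volume : Measure (Fin 2 → ℝ))).withDensity
        fun p : Unit × (Fin 2 → ℝ) => ENNReal.ofReal (Real.exp (-(∑ i, p.2 i ^ 2 / 2))))
        (((⋂ i ∈ ({0} : Finset (Fin 2)), {q : Unit × (Fin 2 → ℝ) | q.2 i ∈ Ioo (-(7 / 6) : ℝ) (7 / 6)}) ∩ univ) \
          ((⋂ i ∈ ({0} : Finset (Fin 2)), {q : Unit × (Fin 2 → ℝ) | q.2 i ∈ Ioo (-1 : ℝ) 1}) ∩ univ))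
      ≤ ENNReal.ofReal ((∏ _i ∈ ({0} : Finset (Fin 2)),
            (1 + 2 * (Real.exp 1 * 2 * ((7 : ℝ) / 6 - 1) / (1 - Real.exp 1 * 2 * ((7 : ℝ) / 6 - 1))))) - 1) *
        (((Measure.dirac ()).prod (volume : Measure (Fin 2 → ℝ))).withDensity
          fun p : Unit × (Fin 2 → ℝ) => ENNReal.ofReal (Real.exp (-(∑ i, p.2 i ^ 2 / 2))))
          ((⋂ i ∈ ({0} : Finset (Fin 2)), {q : Unit × (Fin 2 → ℝ) | q.2 i ∈ Ioo (-1 : ℝ) 1}) ∩ univ) := by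
  haveI := isFiniteMeasure_blockGaussianWeight (κ := Fin 2)
  have hA : Measurable fun p : Unit × (Fin 2 → ℝ) => ∑ i, p.2 i ^ 2 / 2 :=
    Finset.measurable_sum _ fun i _ => (((measurable_pi_apply i).comp measurable_snd).pow_const 2).div_const 2
  have he : Real.exp 1 * 2 * ((7 : ℝ) / 6 - 1) < 1 := by nlinarith [Real.exp_one_lt_d9]
  have hq0 : 0 ≤ 2 * (Real.exp 1 * 2 * ((7 : ℝ) / 6 - 1) / (1 - Real.exp 1 * 2 * ((7 : ℝ) / 6 - 1))) :=
    mul_nonneg zero_le_two (div_nonneg (by positivity) (sub_nonneg.2 he.le))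
  refine coordLetterEnvelopeOdds_block _ {0} (fun _ => Ioo (-1 : ℝ) 1) (fun _ => Ioo (-(7 / 6) : ℝ) (7 / 6))
    (fun _ _ => measurableSet_Ioo) (fun _ _ => measurableSet_Ioo)
    (fun _ _ => Ioo_subset_Ioo (by norm_num) (by norm_num)) _ (fun _ _ => hq0) ?_ MeasurableSet.univ
    (fun _ _ _ _ _ => by simp)
  intro i hi C hC hCi
  rw [Finset.mem_singleton] at hi
  subst hi
  exact hodds_absLetter_of_partialSlopes (Measure.dirac ()) hA 0 (by norm_num) (by norm_num) (by norm_num) he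
    (gaussianBlock_inwardSlopes 0).1 (gaussianBlock_inwardSlopes 0).2 C hC hCi

/-- **A6 WITNESS OF THE JUNCTION** (director-ym STANDING A6 RULE №189 (3)): §3's END
`slotAntiConcentration_restrict_of_recentredDilation_collar` APPLIED with EVERY binder — P2's three about the centre
included — discharged in the kernel: exterior `X = Unit` under `dirac ()`, block `ℝ²` under the Gaussian weight,
centre `m = 0`, slot statistic `U = |w₁|` (homogeneous: transversal with `κ₀ = 1`, `θ = 1`, `ρ = ½`), `C⋆ = univ`,
ONE collar coordinate `0` carrying the kept letter `(−1, 1)` relaxed to `(−7∕6, 7∕6)` at odds `2c∕(1−c)`,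
`c = e∕3`; a satisfiability witness, not an estimate on Bałaban's measure. [textbook] -/
theorem collarJunction_binders_inhabited :
    SlotAntiConcentration
      ((((Measure.dirac ()).prod (volume : Measure (Fin 2 → ℝ))).withDensity
          fun p : Unit × (Fin 2 → ℝ) => ENNReal.ofReal (Real.exp (-(∑ i, p.2 i ^ 2 / 2)))).restrict
        ({p : Unit × (Fin 2 → ℝ) | |p.2 1| < 1} ∩
          (univ ∩ ⋂ i ∈ ({0} : Finset (Fin 2)), {q : Unit × (Fin 2 → ℝ) | q.2 i ∈ Ioo (-1 : ℝ) 1})))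
      (fun p : Unit × (Fin 2 → ℝ) => |p.2 1|) 1 (1 / 2)
      (3 * ((Fintype.card (Fin 2) : ℝ) + 1) *
          (∏ _i ∈ ({0} : Finset (Fin 2)),
            (1 + 2 * (Real.exp 1 * 2 * ((7 : ℝ) / 6 - 1) / (1 - Real.exp 1 * 2 * ((7 : ℝ) / 6 - 1))))) /
        (1 * (1 - 1 / 2))) := by
  haveI := isFiniteMeasure_blockGaussianWeight (κ := Fin 2)
  have hA : Measurable fun p : Unit × (Fin 2 → ℝ) => ∑ i, p.2 i ^ 2 / 2 :=
    Finset.measurable_sum _ fun i _ => (((measurable_pi_apply i).comp measurable_snd).pow_const 2).div_const 2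
  have hg : Measurable fun p : Unit × (Fin 2 → ℝ) => ENNReal.ofReal (Real.exp (-(∑ i, p.2 i ^ 2 / 2))) :=
    ENNReal.measurable_ofReal.comp (Real.measurable_exp.comp hA.neg)
  have hU : Measurable fun p : Unit × (Fin 2 → ℝ) => |p.2 1| := ((measurable_pi_apply 1).comp measurable_snd).abs
  have he : Real.exp 1 * 2 * ((7 : ℝ) / 6 - 1) < 1 := by nlinarith [Real.exp_one_lt_d9]
  have hq0 : 0 ≤ 2 * (Real.exp 1 * 2 * ((7 : ℝ) / 6 - 1) / (1 - Real.exp 1 * 2 * ((7 : ℝ) / 6 - 1))) :=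
    mul_nonneg zero_le_two (div_nonneg (by positivity) (sub_nonneg.2 he.le))
  have hl01 : ∀ l ∈ Icc (1 - 1 / ((Fintype.card (Fin 2) : ℝ) + 1)) (1 : ℝ), 0 ≤ l ∧ l ≤ 1 := by
    intro l hl
    have h := hl.1
    simp only [Fintype.card_fin, Nat.cast_ofNat] at h
    exact ⟨by linarith, hl.2⟩
  refine slotAntiConcentration_restrict_of_recentredDilation_collar (Measure.dirac ()) (m := fun _ => 0)
    measurable_const hg hU MeasurableSet.univ {0} (fun _ => Ioo (-1 : ℝ) 1) (fun _ => Ioo (-(7 / 6) : ℝ) (7 / 6))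
    (fun _ _ => measurableSet_Ioo) (fun _ _ => measurableSet_Ioo)
    (fun _ _ => Ioo_subset_Ioo (by norm_num) (by norm_num)) _ (fun _ _ => hq0) ?_ ?_ (fun _ _ _ _ _ => by simp)
    one_pos (by norm_num) (by norm_num) one_pos ?_ ?_ ?_
  · -- per-coordinate odds: the kept letter on coordinate `0` (§2 with 38k's witness slopes)
    intro i hi C hC hCi
    rw [Finset.mem_singleton] at hi
    subst hi
    exact hodds_absLetter_of_partialSlopes (Measure.dirac ()) hA 0 (by norm_num) (by norm_num) (by norm_num) he
      (gaussianBlock_inwardSlopes 0).1 (gaussianBlock_inwardSlopes 0).2 C hC hCi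
  · -- the slot statistic reads no collar coordinate
    intro i hi z w y
    rw [Finset.mem_singleton] at hi
    subst hi
    show |update w 0 y 1| = |w 1|
    rw [update_of_ne (by decide)]
  · -- henv: images of the cut shell land in the relaxed letter, below the threshold, inside `C⋆ = univ`
    intro l hl p _ h2 hp
    obtain ⟨hl0, hl1⟩ := hl01 l hl
    have hw0 : p.2 0 ∈ Ioo (-1 : ℝ) 1 := (mem_iInter₂.1 hp.2) 0 (Finset.mem_singleton_self 0)
    have h2' : |p.2 1| < 1 := h2
    simp only [zero_add, sub_zero, mem_inter_iff, mem_univ, and_true, Finset.set_biInter_singleton, mem_setOf_eq,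
      Pi.smul_apply, smul_eq_mul, mem_Ioo]
    refine ⟨⟨by nlinarith [mul_nonneg hl0 (show (0 : ℝ) ≤ p.2 0 + 1 by linarith [hw0.1])],
      by nlinarith [mul_nonneg hl0 (show (0 : ℝ) ≤ 1 - p.2 0 by linarith [hw0.2])]⟩, ?_⟩
    rw [abs_mul, abs_of_nonneg hl0]
    exact lt_of_le_of_lt (mul_le_of_le_one_left (abs_nonneg _) hl1) h2'
  · -- hmono: the Gaussian weight does not collapse under contraction toward `0`
    intro l hl p _ _ _
    obtain ⟨hl0, hl1⟩ := hl01 l hl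
    simp only [zero_add, sub_zero]
    refine ENNReal.ofReal_le_ofReal (Real.exp_le_exp.2 (neg_le_neg (Finset.sum_le_sum fun i _ => ?_)))
    simp only [Pi.smul_apply, smul_eq_mul]
    nlinarith [mul_nonneg (mul_nonneg hl0 hl0) (sq_nonneg (p.2 i)), sq_nonneg (p.2 i), mul_le_one₀ hl1 hl0 hl1]
  · -- hRT: `U = |w₁|` is radially transversal with `κ₀ = 1` on `{½ ≤ U}`
    intro p h1 _ _ s hs _ _ _
    have h1' : 1 / 2 ≤ |p.2 1| := by have h := h1; norm_num at h; exact h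
    simp only [zero_add, sub_zero, Pi.smul_apply, smul_eq_mul]
    rw [abs_mul, abs_of_nonneg (by linarith : (0 : ℝ) ≤ s)]
    nlinarith [mul_nonneg (show (0 : ℝ) ≤ s - 1 by linarith) (show (0 : ℝ) ≤ |p.2 1| - 1 / 2 by linarith)]

end Summit.QuantumFields.YangMills.Theorems.N21CollarEnvelopeOdds
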